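import Literature.MathematicalPhysics.QuantumFieldTheory.Balaban1983to89.DagDischargedII
import Literature.MathematicalPhysics.QuantumFieldTheory.Balaban1983to89.B11Prop7Assembly
import Literature.MathematicalPhysics.QuantumFieldTheory.Balaban1983to89.B11Prop2Assembly

/-!
# `Balaban1983to89.B11LeafKnit` — T. Bałaban, *The variational problem and background fields in renormalization group
# method for lattice gauge theories*, Commun. Math. Phys. **102** (1985) 277–309, doi:10.1007/bf01229381
# [Balaban1985Variational]: **the DAG node N07 `Dag.B11_main` («b5 → b6 → b7 → b8 → b9 → b11») KNIT BY NAME** — the B11 leaf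
# `DagBinding.B11Leaf Z` (Thm 1 p. 279, Props 2–8 pp. 281–304, Sect. F p. 305, Prop. 9 p. 309) from its IRREDUNDANT printed parts through
# the paper's own proof DAG (Thm 1 ⇐ Prop 7 ∧ Prop 8 ∧ Sect. F, `B11.thm1_of_prop7_prop8_sectF`; Prop 7 ⇐ Props 2, 5, 6,
# `B11Prop7Assembly.prop7Printed_of_props_cap`; Prop 2 ⇐ [6] Thm 2, `B11Prop2Assembly.prop2Printed_of_thm2`), and the node at any run of a
# binding of record from that leaf

statement-level bookkeeping over published theorems with citation tags; proofs = kernel composition of landed modules BY NAME; nothing here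
is a claim about the Yang–Mills mass gap

PDF held: `paper:balaban1985-cmp102-variational-background` (journal page = PDF page + 276).

CITATION HEADER (lean-in-tree rule 2026-08-18) / WHAT IS REPRODUCED.  Cell `pub-ymgap`, Track A node N07 = [B11] (YM-PLAN §2b row N07;
statement of record `YMDAG.N07 w P := Dag.B11_main (DagBinding.leavesP w P)`, own leaf `b11 ↦ DagBinding.B11Leaf Z` over the B11 carrier
bundle `Z : DagBinding.PrintedCarriers11`), prover seat `pub-ymgap-dag-n07-a` (KNIT-BY-NAME).  A NEW LEAF over `DagDischargedII`
(`Upstream.ofPrintedAllXPN`), `B11Prop7Assembly`, `B11Prop2Assembly`; nothing there is modified; NO definition is introduced (theorems only).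
§1 `b11Leaf_of_parts`: `B11Leaf Z` (ten conjuncts t1 p2 … p9 sF) from EIGHT printed statements — Props 2, 3, 4, 5, 6, 8, Sect. F, Prop 9 —
   plus the dictionary the tree's assembly theorems consume (the Theorem-1 carrier laws `B11.VarProblemX.Laws`, the bridge
   `B11Prop7Assembly.Bridge` famX ↔ famLG with its located laws (15)–(18) p. 280 and the located existence leaves (112), (123)–(142)
   pp. 294–299 with the radius cap of p. 301, the Sect. A law «every V with (7) admits a background U₀ with (14)» (12)–(14) p. 280 FOR
   ε₁ BELOW A THRESHOLD ONLY — where the induction on k supplies it, `prop7_conjunct_of_parts_small` — and the printed inequalities among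
   the constants B₀ ≤ 4B₁, B₃ ≥ 1, C₁ ≥ 1); Theorem 1 and Proposition 7 are DERIVED, by
   `B11.thm1_of_prop7_prop8_sectF` (p. 281 / p. 304 «Now we define a₁ …») and `B11Prop7Assembly.prop7Printed_of_props_cap` (p. 296 (122),
   p. 299), for `Z.famV = fun i ↦ (Z.famX i).toVarProblem` (Theorem 1 is stated on the carrier Props 7, 8 and Sect. F speak about).
§2 `b11_main_iff_leaf`, `b11_main_of_leaf`, `b11_main_of_parts`: at any run `P` of a binding world with
   `w.up P = Upstream.ofPrintedAllXPN X Y Z V W` the node `Dag.B11_main (leavesP w P)` IS «b5 → b6 → b7 → b8 → b9 → B11Leaf Z» (the sentence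
   of `Node00.b11_main_iff_of_up` (module `Node00/CarriersFrame`), stated without the NODE 00 frame), hence follows from the leaf, hence from the parts of §1.
§3 THE IN-EDGE b8: Proposition 2 from the node's OWN antecedent `b8` — the faithful [6] leaf `DagBinding.B8LeafR …`, whose conjunct `t2` is
   [Balaban1985RegularSpaces] Thm 2 (`B8.Thm2Printed`) on the run's B8 family `X.fam8R` — through a re-indexing `φ : Z.I11 → X.I8b` and the
   bridges `B11Prop2Assembly.Bridge62` with their located laws (pp. 280–281): `prop2_exists_of_b8` gives `∃ B₁ c₁ > 0, B11.Prop2Printed B₁ Z.B₃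
   Z.C₁ c₁ Z.famLG`.  INTERFACE FINDING (typed, not a gap in print): `B11Leaf Z` fixes [6]'s constants B₁ («we have B₁ = 5dLB₀» p. 296 =
   [6] Prop. 3 p. 87, `B11.B1_eq_B8Prop3`) and c₁ as FIELDS of `Z`, shared with Prop 5 and (122), while `B8.Thm2Printed` quantifies them
   existentially; so the leaf's p2 AT `Z.B₁, Z.c₁` needs Theorem 2 of [6] AT GIVEN CONSTANTS on `X.fam8R` — `prop2_of_thm2At` (input = the
   body of `B8.Thm2Printed` at (Z.B₁, B₂, Z.c₁), the form `B11Prop2Assembly.prop2Printed_of_thm2_at` consumes) and the node theorem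
   `b11_main_of_parts_thm2At` with p2 so supplied.
§4 `b11_main_of_record`: the R422 shape — for ANY record predicate `Rec` on binding worlds under which every run's B11 group satisfies its
   leaf, N07 holds at every `Rec`-world and run (the sentence a NODE-00 pin of the B11 group closes; cf. dagwriter `stub_N04_of_stage2`).

THE HYPOTHESIS LIST OF `b11_main_of_parts` IS THE LIST OF WHAT A NODE-00 PIN OF THE B11 GROUP MUST CARRY FOR N07 (today the group is FREE at
Stages 1–3: `Node00.IsWorldOfRecord₃` (module `Node00/Carriers3`) quantifies `Z` existentially per run; `Node00.b11_main_iff_of_up` (module `Node00/CarriersFrame`)).  Tree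
inhabitants of the parts on MODEL families (not Bałaban's lattice objects; count-neutral): p3 `B11Prop3Model.prop3Printed_model` /
`B11Prop3Concrete.prop3Printed_concrete`, p4 p6 `B11Prop6Model.prop4Printed_model` / `prop6Printed_model`, `B11Prop4ModelW80`, p5
`B11Prop5Model.prop5Printed_model`, p2 p5 p6 p7 `B11Prop7ModelBridge.prop2Printed_lg` / `prop5Printed_lg` / `prop6Printed_lg` /
`prop7Printed_via_assembly`; p8 sF by reduction to located leaves `B11Prop8Assembly.prop8Printed_of_halvingStep`,
`B11SectFAssembly.sectFPrinted_of_leaves`; the induction on k behind the Sect. A law: `B11Thm1.thm1Printed_allLevels` (repaired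
`B11Thm1TwoTier`, cell GAPS G-B11-A1b); **p9 `B11.Prop9Printed`: NO inhabitant in the tree** ((190) rests on (189), omitted in print p. 308,
GAPS G-B11-G2 — the operator layer is `B11SectG`).
HONEST FRAMING: a count-neutral Track-A side landing (YM-PLAN §1); NOT a discharge of node N07; one finite T⁴ programme at fixed ε;
Bałaban AS PRINTED with page locators; nothing continuum / ℝ⁴ / OS / mass-gap / Clay.
-/

namespace Literature.MathematicalPhysics.QuantumFieldTheory.Balaban1983to89.B11LeafKnit

open Literature.MathematicalPhysics.QuantumFieldTheory.Balaban1983to89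
open Literature.MathematicalPhysics.QuantumFieldTheory.Balaban1983to89.B11
open Literature.MathematicalPhysics.QuantumFieldTheory.Balaban1983to89.DagBinding
open Literature.MathematicalPhysics.QuantumFieldTheory.Balaban1983to89.B11Prop7Assembly (Bridge ExistenceLeavesCap)
open Literature.MathematicalPhysics.QuantumFieldTheory.Balaban1983to89.B11Prop2Assembly (Bridge62)

/-! ## §1. The B11 leaf from its irredundant printed parts -/

section Leaf

variable (Z : PrintedCarriers11)

/-- **Theorem 1 inside the leaf is a consequence of Prop 7, Prop 8 and Sect. F** (p. 281: *"This will prove Theorem 1 with worse bounds.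
Next we will improve the bounds and we will complete the proof of this theorem"*; p. 304: *"Now we define a₁ as a largest constant such,
that the restriction ε₁ ≤ a₁ implies all the other restrictions we have imposed on ε₁"*) — `B11.thm1_of_prop7_prop8_sectF` BY NAME, read on
the bundle `Z` whose Theorem-1 family is the one Props 7, 8, Sect. F speak about (`Z.famV i = (Z.famX i).toVarProblem`).
[cite: Balaban1985Variational, Thm 1 p.279; p.281; p.304] -/
theorem thm1_conjunct_of_parts (plaws : ∀ i, (Z.famX i).Laws) (hB₃ : 0 < Z.B₃) (hC₁ : 0 < Z.C₁)
    (hV : Z.famV = fun i => (Z.famX i).toVarProblem)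
    (p7 : Prop7Printed Z.B₃ Z.C₁ Z.famX) (p8 : Prop8Printed Z.B₃ Z.famX) (sF : SectFPrinted Z.B₃ Z.famX) :
    Thm1Printed Z.famV := by
  rw [hV]
  exact thm1_of_prop7_prop8_sectF Z.famX Z.B₃ Z.C₁ hB₃ hC₁ plaws p7 p8 sF

/-- **Proposition 7 inside the leaf is a consequence of Props 2, 5, 6** (p. 296 (122): *"by Propositions 5 and 6 there is at most one
critical configuration of (5) in (19)–(21). We get the same conclusion for the second problem …"*; p. 299: *"Hence A′ = 0 is a minimum of
the functional (143) and this implies that U_k is a minimal configuration"*) — `B11Prop7Assembly.prop7Printed_of_props_cap` BY NAME, for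
the bundle's Sect. A–E family `Z.famLG` bridged to its Theorem-1 family `Z.famX` (located laws (15)–(18) p. 280, located existence leaves
with the radius cap of p. 301, the Sect. A law (12)–(14) p. 280, and the printed relations B₀ ≤ 4B₁, B₃ ≥ 1, C₁ ≥ 1 among the constants).
[cite: Balaban1985Variational, Prop. 7 p.299; (122) p.296; (12)–(18) p.280] -/
theorem prop7_conjunct_of_parts (β : ∀ i, Bridge (Z.famX i) (Z.famLG i)) {O₁ O₂ e₅ : ℝ}
    (laws : ∀ i, (β i).Laws Z.C₁ Z.B₃) (leaves : ∀ i, ExistenceLeavesCap (β i) Z.B₀ Z.B₃ Z.C₁ O₁ O₂ e₅)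
    (hB₀ : 0 < Z.B₀) (hB₁ : 0 < Z.B₁) (hB₃ : 1 ≤ Z.B₃) (hC₁ : 1 ≤ Z.C₁) (hB₀B₁ : Z.B₀ ≤ 4 * Z.B₁) (hc₁ : 0 < Z.c₁)
    (hO₁ : 0 < O₁) (hO₂ : 0 < O₂) (he₅ : 0 < e₅)
    (hbg : ∀ (i : Z.I11) (ε₁ : ℝ) (V : (Z.famX i).Bdry), 0 < ε₁ → (Z.famX i).Reg7 ε₁ V →
      ∃ U₀ : (Z.famLG i).Cfg, (Z.famLG i).Sat14 (Z.C₁ * Z.B₃ * ε₁) (Z.C₁ * ε₁) ((β i).bdry V) U₀)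
    (p2 : Prop2Printed Z.B₁ Z.B₃ Z.C₁ Z.c₁ Z.famLG) (p5 : Prop5Printed Z.B₁ Z.B₃ Z.C₁ Z.famLG)
    (p6 : Prop6Printed Z.B₀ Z.B₃ Z.C₁ Z.famLG) :
    Prop7Printed Z.B₃ Z.C₁ Z.famX :=
  B11Prop7Assembly.prop7Printed_of_props_cap β laws leaves hB₀ hB₁ hB₃ hC₁ hB₀B₁ hc₁ hO₁ hO₂ he₅ p2 p5 p6 hbg

/-- **Proposition 7 inside the leaf, with the Sect. A law only where the induction supplies it.**  The printed background U₀ of (14) comes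
from Theorem 1 at level k − 1 applied to V₀ (p. 280 (11)–(13): *"We assume that ε₁ ≤ a₁, B₃ε₁ ≤ ε₀ ≤ a₀ and we use the inductive
assumption"*; k = 1: *"we take simply U₀ = V₀"*), i.e. only for ε₁ below a threshold `a` (the shape `B11Thm1.background_of_thm1At`
delivers).  From the background-dependent form `B11Prop7Assembly.prop7From14_of_props_cap` the printed (background-free) Proposition 7
still follows, with the constants a₀ ↦ min{a₀, B₃a}, a′₁ ↦ min{a′₁, a} (its first clause is only invoked under B₃ε₁ ≤ ε₀ ≤ a₀, its second
under ε₁ ≤ a′₁; cell GAPS G-pv12-1). [cite: Balaban1985Variational, Prop. 7 p.299; (11)–(14) pp.279–280] -/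
theorem prop7_conjunct_of_parts_small (β : ∀ i, Bridge (Z.famX i) (Z.famLG i)) {O₁ O₂ e₅ a : ℝ}
    (laws : ∀ i, (β i).Laws Z.C₁ Z.B₃) (leaves : ∀ i, ExistenceLeavesCap (β i) Z.B₀ Z.B₃ Z.C₁ O₁ O₂ e₅)
    (hB₀ : 0 < Z.B₀) (hB₁ : 0 < Z.B₁) (hB₃ : 1 ≤ Z.B₃) (hC₁ : 1 ≤ Z.C₁) (hB₀B₁ : Z.B₀ ≤ 4 * Z.B₁) (hc₁ : 0 < Z.c₁)
    (hO₁ : 0 < O₁) (hO₂ : 0 < O₂) (he₅ : 0 < e₅) (ha : 0 < a)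
    (hbg : ∀ (i : Z.I11) (ε₁ : ℝ) (V : (Z.famX i).Bdry), 0 < ε₁ → ε₁ ≤ a → (Z.famX i).Reg7 ε₁ V →
      ∃ U₀ : (Z.famLG i).Cfg, (Z.famLG i).Sat14 (Z.C₁ * Z.B₃ * ε₁) (Z.C₁ * ε₁) ((β i).bdry V) U₀)
    (p2 : Prop2Printed Z.B₁ Z.B₃ Z.C₁ Z.c₁ Z.famLG) (p5 : Prop5Printed Z.B₁ Z.B₃ Z.C₁ Z.famLG)
    (p6 : Prop6Printed Z.B₀ Z.B₃ Z.C₁ Z.famLG) :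
    Prop7Printed Z.B₃ Z.C₁ Z.famX := by
  obtain ⟨a₀, a₁', O, ha₀, ha₁', hO, H⟩ :=
    B11Prop7Assembly.prop7From14_of_props_cap β laws leaves hB₀ hB₁ hB₃ hC₁ hB₀B₁ hc₁ hO₁ hO₂ he₅ p2 p5 p6
  have hB₃pos : 0 < Z.B₃ := lt_of_lt_of_le one_pos hB₃
  refine ⟨min a₀ (Z.B₃ * a), min a₁' a, O, lt_min ha₀ (mul_pos hB₃pos ha), lt_min ha₁' ha, hO,
    fun i ε₀ ε₁ hε₁ V hV => ⟨?_, ?_⟩⟩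
  · intro hε₀ hB₃ε
    have hε₁a : ε₁ ≤ a := by
      have h : Z.B₃ * ε₁ ≤ Z.B₃ * a := hB₃ε.trans (hε₀.trans (min_le_right _ _))
      exact le_of_mul_le_mul_left h hB₃pos
    obtain ⟨U₀, h14⟩ := hbg i ε₁ V hε₁ hε₁a hV
    exact (H i ε₀ ε₁ hε₁ V hV U₀ h14).1 (hε₀.trans (min_le_left _ _)) hB₃ε
  · intro hε₁a
    obtain ⟨U₀, h14⟩ := hbg i ε₁ V hε₁ (hε₁a.trans (min_le_right _ _)) hV
    exact (H i ε₀ ε₁ hε₁ V hV U₀ h14).2 (hε₁a.trans (min_le_left _ _))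

/-- **THE B11 LEAF FROM ITS IRREDUNDANT PRINTED PARTS.**  The ten conjuncts of `DagBinding.B11Leaf Z` — Thm 1 (p. 279), Props 2–8
(pp. 281–304), the Sect. F regularity conclusion (p. 305), Prop 9 (p. 309), each the module `…B11`'s own typed statement — follow from
EIGHT of them (Props 2, 3, 4, 5, 6, 8, Sect. F, Prop 9) plus the dictionary the tree's assembly theorems consume: Prop 7 by
`prop7_conjunct_of_parts` (⇐ Props 2, 5, 6), then Thm 1 by `thm1_conjunct_of_parts` (⇐ Prop 7, Prop 8, Sect. F).  Every hypothesis is a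
NAMED tree `Prop` or a located law; nothing of the series is asserted. [cite: Balaban1985Variational, Thm 1 p.279, Props 2–9 pp.281–309] -/
theorem b11Leaf_of_parts (β : ∀ i, Bridge (Z.famX i) (Z.famLG i)) {O₁ O₂ e₅ a : ℝ}
    (laws : ∀ i, (β i).Laws Z.C₁ Z.B₃) (leaves : ∀ i, ExistenceLeavesCap (β i) Z.B₀ Z.B₃ Z.C₁ O₁ O₂ e₅)
    (plaws : ∀ i, (Z.famX i).Laws)
    (hB₀ : 0 < Z.B₀) (hB₁ : 0 < Z.B₁) (hB₃ : 1 ≤ Z.B₃) (hC₁ : 1 ≤ Z.C₁) (hB₀B₁ : Z.B₀ ≤ 4 * Z.B₁) (hc₁ : 0 < Z.c₁)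
    (hO₁ : 0 < O₁) (hO₂ : 0 < O₂) (he₅ : 0 < e₅)
    (ha : 0 < a)
    (hbg : ∀ (i : Z.I11) (ε₁ : ℝ) (V : (Z.famX i).Bdry), 0 < ε₁ → ε₁ ≤ a → (Z.famX i).Reg7 ε₁ V →
      ∃ U₀ : (Z.famLG i).Cfg, (Z.famLG i).Sat14 (Z.C₁ * Z.B₃ * ε₁) (Z.C₁ * ε₁) ((β i).bdry V) U₀)
    (hV : Z.famV = fun i => (Z.famX i).toVarProblem)
    (p2 : Prop2Printed Z.B₁ Z.B₃ Z.C₁ Z.c₁ Z.famLG) (p3 : Prop3Printed Z.C₁ Z.B₃ Z.C₂ Z.C₃ Z.B₀ Z.c1h Z.c₄ Z.δ₀ Z.famLG)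
    (p4 : Prop4Printed Z.C₁ Z.B₃ Z.famLG) (p5 : Prop5Printed Z.B₁ Z.B₃ Z.C₁ Z.famLG) (p6 : Prop6Printed Z.B₀ Z.B₃ Z.C₁ Z.famLG)
    (p8 : Prop8Printed Z.B₃ Z.famX) (sF : SectFPrinted Z.B₃ Z.famX) (p9 : Prop9Printed Z.B₅ Z.C₁ Z.β₀ Z.δ₀ Z.famAn) :
    B11Leaf Z :=
  have p7 : Prop7Printed Z.B₃ Z.C₁ Z.famX :=
    prop7_conjunct_of_parts_small Z β laws leaves hB₀ hB₁ hB₃ hC₁ hB₀B₁ hc₁ hO₁ hO₂ he₅ ha hbg p2 p5 p6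
  { t1 := thm1_conjunct_of_parts Z plaws (lt_of_lt_of_le one_pos hB₃) (lt_of_lt_of_le one_pos hC₁) hV p7 p8 sF
    p2 := p2
    p3 := p3
    p4 := p4
    p5 := p5
    p6 := p6
    p7 := p7
    p8 := p8
    sF := sF
    p9 := p9 }

/-- Conversely the leaf projects onto the eight parts (trivial; recorded so that «the parts» and «the leaf» are interchangeable for the
referee modulo the dictionary). [cite: Balaban1985Variational, Props 2–9 pp.281–309] -/
theorem parts_of_b11Leaf (h : B11Leaf Z) :
    Prop2Printed Z.B₁ Z.B₃ Z.C₁ Z.c₁ Z.famLG ∧ Prop3Printed Z.C₁ Z.B₃ Z.C₂ Z.C₃ Z.B₀ Z.c1h Z.c₄ Z.δ₀ Z.famLG ∧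
      Prop4Printed Z.C₁ Z.B₃ Z.famLG ∧ Prop5Printed Z.B₁ Z.B₃ Z.C₁ Z.famLG ∧ Prop6Printed Z.B₀ Z.B₃ Z.C₁ Z.famLG ∧
        Prop8Printed Z.B₃ Z.famX ∧ SectFPrinted Z.B₃ Z.famX ∧ Prop9Printed Z.B₅ Z.C₁ Z.β₀ Z.δ₀ Z.famAn :=
  ⟨h.p2, h.p3, h.p4, h.p5, h.p6, h.p8, h.sF, h.p9⟩

end Leaf

/-! ## §2. The node at a run of a binding of record -/

section Node

variable (w : WorldP) (P : B12.RunParams) (X : PrintedCarriersR) (Y : PrintedCarriers9X) (Z : PrintedCarriers11)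
  (V : PrintedCarriers14R) (W : PrintedCarriers15)

/-- **N07 unfolded at a binding of record** (`Iff.rfl` bookkeeping): at a run `P` of a world with
`w.up P = Upstream.ofPrintedAllXPN X Y Z V W`, the node `Dag.B11_main (leavesP w P)` («b5 → b6 → b7 → b8 → b9 → b11», the citations
[2] = B5, [3] = B6, [4] = B7, [6] = B8, [5] = B9 of p. 309 inside the type) IS the implication from the typed leaves of [B5], [B6], [B7],
[B8], [B9] at the run's carriers to `B11Leaf Z` at the run's B11 group — the sentence of `Node00.b11_main_iff_of_up` (module `Node00/CarriersFrame`), stated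
without the NODE 00 frame. [cite: Balaban1985Variational, Thm 1 p.279, Props 2–9 pp.281–309 (dictionary, bookkeeping)] -/
theorem b11_main_iff_leaf (hP : w.up P = Upstream.ofPrintedAllXPN X Y Z V W) :
    Dag.B11_main (leavesP w P) ↔
      ((Upstream.ofPrintedAllXPN X Y Z V W).b5 → (Upstream.ofPrintedAllXPN X Y Z V W).b6 →
        (Upstream.ofPrintedAllXPN X Y Z V W).b7 → (Upstream.ofPrintedAllXPN X Y Z V W).b8 →
          (Upstream.ofPrintedAllXPN X Y Z V W).b9 → B11Leaf Z) := by
  show ((w.up P).b5 → (w.up P).b6 → (w.up P).b7 → (w.up P).b8 → (w.up P).b9 → (w.up P).b11) ↔ _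
  rw [hP]
  exact Iff.rfl

/-- **N07 from its leaf**: `B11Leaf Z` at the B11 group of a binding of record `w.up P = Upstream.ofPrintedAllXPN X Y Z V W` gives the
node `Dag.B11_main (leavesP w P)`.  The antecedent leaves b5, b6, b7, b9 are not consumed here: in print [2], [3], [4], [5] enter through
the operators G, H, Q, the scale-sum constant c₁(½) of [3] Lemma 2.1, the constants C₂, C₃, c₄ of [4] Props 4, 5, 7 and B₀ of [5] Thm 3.13,
which the tree carries as the parameters and located hypotheses of the B11 modules; b8 ([6] Thm 2) is consumed in §3.
[cite: Balaban1985Variational, Thm 1 p.279, Props 2–9 pp.281–309 (dictionary, bookkeeping)] -/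
theorem b11_main_of_leaf (hP : w.up P = Upstream.ofPrintedAllXPN X Y Z V W) (h : B11Leaf Z) :
    Dag.B11_main (leavesP w P) :=
  (b11_main_iff_leaf w P X Y Z V W hP).mpr fun _ _ _ _ _ => h

/-- **N07 FROM THE PRINTED PARTS AT A BINDING OF RECORD** — the discharge-shaped sentence: for every binding world and run with
`w.up P = Upstream.ofPrintedAllXPN X Y Z V W`, the inputs of `b11Leaf_of_parts` at the run's B11 group `Z` give `Dag.B11_main (leavesP w P)`.
ITS HYPOTHESIS LIST IS WHAT A NODE-00 PIN OF THE B11 GROUP MUST CARRY FOR N07 (route stub shape `stub_N07_… : Dag.B11_main …`); today the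
group is free at Stages 1–3, nothing is discharged here. [cite: Balaban1985Variational, Thm 1 p.279, Props 2–9 pp.281–309] -/
theorem b11_main_of_parts (hP : w.up P = Upstream.ofPrintedAllXPN X Y Z V W)
    (β : ∀ i, Bridge (Z.famX i) (Z.famLG i)) {O₁ O₂ e₅ a : ℝ}
    (laws : ∀ i, (β i).Laws Z.C₁ Z.B₃) (leaves : ∀ i, ExistenceLeavesCap (β i) Z.B₀ Z.B₃ Z.C₁ O₁ O₂ e₅)
    (plaws : ∀ i, (Z.famX i).Laws)
    (hB₀ : 0 < Z.B₀) (hB₁ : 0 < Z.B₁) (hB₃ : 1 ≤ Z.B₃) (hC₁ : 1 ≤ Z.C₁) (hB₀B₁ : Z.B₀ ≤ 4 * Z.B₁) (hc₁ : 0 < Z.c₁)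
    (hO₁ : 0 < O₁) (hO₂ : 0 < O₂) (he₅ : 0 < e₅)
    (ha : 0 < a)
    (hbg : ∀ (i : Z.I11) (ε₁ : ℝ) (V : (Z.famX i).Bdry), 0 < ε₁ → ε₁ ≤ a → (Z.famX i).Reg7 ε₁ V →
      ∃ U₀ : (Z.famLG i).Cfg, (Z.famLG i).Sat14 (Z.C₁ * Z.B₃ * ε₁) (Z.C₁ * ε₁) ((β i).bdry V) U₀)
    (hV : Z.famV = fun i => (Z.famX i).toVarProblem)
    (p2 : Prop2Printed Z.B₁ Z.B₃ Z.C₁ Z.c₁ Z.famLG) (p3 : Prop3Printed Z.C₁ Z.B₃ Z.C₂ Z.C₃ Z.B₀ Z.c1h Z.c₄ Z.δ₀ Z.famLG)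
    (p4 : Prop4Printed Z.C₁ Z.B₃ Z.famLG) (p5 : Prop5Printed Z.B₁ Z.B₃ Z.C₁ Z.famLG) (p6 : Prop6Printed Z.B₀ Z.B₃ Z.C₁ Z.famLG)
    (p8 : Prop8Printed Z.B₃ Z.famX) (sF : SectFPrinted Z.B₃ Z.famX) (p9 : Prop9Printed Z.B₅ Z.C₁ Z.β₀ Z.δ₀ Z.famAn) :
    Dag.B11_main (leavesP w P) :=
  b11_main_of_leaf w P X Y Z V W hP
    (b11Leaf_of_parts Z β laws leaves plaws hB₀ hB₁ hB₃ hC₁ hB₀B₁ hc₁ hO₁ hO₂ he₅ ha hbg hV p2 p3 p4 p5 p6 p8 sF p9)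

end Node

/-! ## §3. The in-edge b8: Proposition 2 from [6] Theorem 2 on the run's B8 family -/

section EdgeB8

/-- [Balaban1985RegularSpaces] Thm 2 as typed (`B8.Thm2Printed`: constants chosen before the instance) is stable under re-indexing the
family (bookkeeping). [cite: Balaban1985RegularSpaces, Thm 2 p.83] -/
theorem thm2Printed_reindex {I J : Type} (fam : I → B8.GFData) (φ : J → I) (h : B8.Thm2Printed fam) :
    B8.Thm2Printed fun j => fam (φ j) := by
  obtain ⟨B₁, B₂, c₁, hB₁, hB₂, hc₁, H⟩ := h
  exact ⟨B₁, B₂, c₁, hB₁, hB₂, hc₁, fun j => H (φ j)⟩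

variable (X : PrintedCarriersR) (Y : PrintedCarriers9X) (Z : PrintedCarriers11) (V : PrintedCarriers14R) (W : PrintedCarriers15)

/-- The `b8` leaf of the N-binding is the faithful [6] bundle `DagBinding.B8LeafR` over the run's family `X.fam8R`; its conjunct `t2` is
[Balaban1985RegularSpaces] Theorem 2 (`rfl` bookkeeping). [cite: Balaban1985RegularSpaces, Thm 2 p.83] -/
theorem thm2_of_b8 (hb8 : (Upstream.ofPrintedAllXPN X Y Z V W).b8) :
    B8.Thm2Printed fun i : X.I8b => (X.fam8R i).toGFData :=
  hb8.t2

/-- **Proposition 2 from the node's own antecedent b8** (p. 280: *"Configurations U from the space (18), and U₀, satisfy the assumptions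
(1.33)–(1.35) of this theorem [Theorem 2 of [6]] with α₀ = ε₀, α₁ = C₁ε₁ … U₁ = U′^{u⁻¹} satisfies the conditions (1.36)–(1.39) of [6]"*):
if the run's B11 Sect. A–E family `Z.famLG` is read on [6]'s carriers through a re-indexing `φ : Z.I11 → X.I8b` into the run's B8 family and
bridges with the located laws of pp. 280–281 (`B11Prop2Assembly.Bridge62.Laws`), then the `b8` leaf gives Proposition 2 with [6]'s OWN
(existentially quantified) constants B₁, c₁ — `B11Prop2Assembly.prop2Printed_of_thm2` BY NAME.
[cite: Balaban1985Variational, Prop. 2 p.281; pp.280–281] -/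
theorem prop2_exists_of_b8 (hb8 : (Upstream.ofPrintedAllXPN X Y Z V W).b8) (φ : Z.I11 → X.I8b)
    (β62 : ∀ i, Bridge62 (X.fam8R (φ i)).toGFData (Z.famLG i)) (laws62 : ∀ i, (β62 i).Laws Z.C₁ Z.B₃) (hC₁ : 0 < Z.C₁) :
    ∃ B₁ c₁ : ℝ, 0 < B₁ ∧ 0 < c₁ ∧ Prop2Printed B₁ Z.B₃ Z.C₁ c₁ Z.famLG :=
  B11Prop2Assembly.prop2Printed_of_thm2 β62 laws62 hC₁
    (thm2Printed_reindex (fun i : X.I8b => (X.fam8R i).toGFData) φ (thm2_of_b8 X Y Z V W hb8))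

/-- **Proposition 2 AT THE LEAF'S CONSTANTS from [6] Theorem 2 at given constants** (INTERFACE form): `B11Leaf Z` fixes B₁ (*"we have
B₁ = 5dLB₀"*, p. 296 = [6] Prop. 3 p. 87, `B11.B1_eq_B8Prop3`) and c₁ as fields of `Z`; the input is the BODY of `B8.Thm2Printed` on the run's
B8 family at (Z.B₁, B₂, Z.c₁) (existence half), consumed by `B11Prop2Assembly.prop2Printed_of_thm2_at`.
[cite: Balaban1985Variational, Prop. 2 p.281; p.296; Balaban1985RegularSpaces, Thm 2 p.83, Prop. 3 p.87] -/
theorem prop2_of_thm2At (φ : Z.I11 → X.I8b) (β62 : ∀ i, Bridge62 (X.fam8R (φ i)).toGFData (Z.famLG i))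
    (laws62 : ∀ i, (β62 i).Laws Z.C₁ Z.B₃) (hC₁ : 0 < Z.C₁) {B₂ : ℝ}
    (H : ∀ j : X.I8b, ∀ α₀ α₁ : ℝ, 0 < α₀ → 0 < α₁ → α₀ + α₁ ≤ Z.c₁ →
      ∀ U₀ : (X.fam8R j).Cfg, ∀ U' : (X.fam8R j).Pert,
        (X.fam8R j).InA α₀ U₀ → (X.fam8R j).Reg335 α₀ U₀ → (X.fam8R j).InAAx α₀ U₀ U' → (X.fam8R j).avgClose α₁ U₀ U' →
          ∃ u : (X.fam8R j).GT, (X.fam8R j).Restricted U₀ u ∧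
            ((X.fam8R j).C136 Z.B₁ B₂ (α₀ + α₁) U₀ ((X.fam8R j).act U' u) ∧ (X.fam8R j).C137 α₁ U₀ ((X.fam8R j).act U' u) ∧
              (X.fam8R j).Landau U₀ ((X.fam8R j).act U' u) ∧ (X.fam8R j).C139 Z.B₁ (α₀ + α₁) U₀ ((X.fam8R j).act U' u))) :
    Prop2Printed Z.B₁ Z.B₃ Z.C₁ Z.c₁ Z.famLG :=
  B11Prop2Assembly.prop2Printed_of_thm2_at β62 (B₂ := B₂) laws62 hC₁ fun i => H (φ i)

/-- **N07 FROM THE PRINTED PARTS WITH PROP 2 KNIT TO THE RUN'S B8 FAMILY**: as `b11_main_of_parts`, the input p2 replaced by [6] Theorem 2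
at the leaf's constants on `X.fam8R` through the bridges of pp. 280–281 (`prop2_of_thm2At`).
[cite: Balaban1985Variational, Thm 1 p.279, Prop. 2 p.281, Props 3–9 pp.289–309] -/
theorem b11_main_of_parts_thm2At (w : WorldP) (P : B12.RunParams) (hP : w.up P = Upstream.ofPrintedAllXPN X Y Z V W)
    (φ : Z.I11 → X.I8b) (β62 : ∀ i, Bridge62 (X.fam8R (φ i)).toGFData (Z.famLG i)) (laws62 : ∀ i, (β62 i).Laws Z.C₁ Z.B₃)
    {B₂ : ℝ}
    (H : ∀ j : X.I8b, ∀ α₀ α₁ : ℝ, 0 < α₀ → 0 < α₁ → α₀ + α₁ ≤ Z.c₁ →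
      ∀ U₀ : (X.fam8R j).Cfg, ∀ U' : (X.fam8R j).Pert,
        (X.fam8R j).InA α₀ U₀ → (X.fam8R j).Reg335 α₀ U₀ → (X.fam8R j).InAAx α₀ U₀ U' → (X.fam8R j).avgClose α₁ U₀ U' →
          ∃ u : (X.fam8R j).GT, (X.fam8R j).Restricted U₀ u ∧
            ((X.fam8R j).C136 Z.B₁ B₂ (α₀ + α₁) U₀ ((X.fam8R j).act U' u) ∧ (X.fam8R j).C137 α₁ U₀ ((X.fam8R j).act U' u) ∧
              (X.fam8R j).Landau U₀ ((X.fam8R j).act U' u) ∧ (X.fam8R j).C139 Z.B₁ (α₀ + α₁) U₀ ((X.fam8R j).act U' u)))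
    (β : ∀ i, Bridge (Z.famX i) (Z.famLG i)) {O₁ O₂ e₅ a : ℝ}
    (laws : ∀ i, (β i).Laws Z.C₁ Z.B₃) (leaves : ∀ i, ExistenceLeavesCap (β i) Z.B₀ Z.B₃ Z.C₁ O₁ O₂ e₅)
    (plaws : ∀ i, (Z.famX i).Laws)
    (hB₀ : 0 < Z.B₀) (hB₁ : 0 < Z.B₁) (hB₃ : 1 ≤ Z.B₃) (hC₁ : 1 ≤ Z.C₁) (hB₀B₁ : Z.B₀ ≤ 4 * Z.B₁) (hc₁ : 0 < Z.c₁)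
    (hO₁ : 0 < O₁) (hO₂ : 0 < O₂) (he₅ : 0 < e₅)
    (ha : 0 < a)
    (hbg : ∀ (i : Z.I11) (ε₁ : ℝ) (V : (Z.famX i).Bdry), 0 < ε₁ → ε₁ ≤ a → (Z.famX i).Reg7 ε₁ V →
      ∃ U₀ : (Z.famLG i).Cfg, (Z.famLG i).Sat14 (Z.C₁ * Z.B₃ * ε₁) (Z.C₁ * ε₁) ((β i).bdry V) U₀)
    (hV : Z.famV = fun i => (Z.famX i).toVarProblem)
    (p3 : Prop3Printed Z.C₁ Z.B₃ Z.C₂ Z.C₃ Z.B₀ Z.c1h Z.c₄ Z.δ₀ Z.famLG)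
    (p4 : Prop4Printed Z.C₁ Z.B₃ Z.famLG) (p5 : Prop5Printed Z.B₁ Z.B₃ Z.C₁ Z.famLG) (p6 : Prop6Printed Z.B₀ Z.B₃ Z.C₁ Z.famLG)
    (p8 : Prop8Printed Z.B₃ Z.famX) (sF : SectFPrinted Z.B₃ Z.famX) (p9 : Prop9Printed Z.B₅ Z.C₁ Z.β₀ Z.δ₀ Z.famAn) :
    Dag.B11_main (leavesP w P) :=
  b11_main_of_parts w P X Y Z V W hP β laws leaves plaws hB₀ hB₁ hB₃ hC₁ hB₀B₁ hc₁ hO₁ hO₂ he₅ ha hbg hV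
    (prop2_of_thm2At X Z φ β62 laws62 (lt_of_lt_of_le one_pos hC₁) H) p3 p4 p5 p6 p8 sF p9

end EdgeB8

/-! ## §4. The record-predicate shape -/

/-- **N07 for every record predicate pinning the B11 group with its leaf** (the shape a NODE-00 stage / the route's `Rec` parameter closes,
cf. the dagwriter's `stub_N04_of_stage2`): if under `Rec` every run of the world is bound as `Upstream.ofPrintedAllXPN X Y Z V W` with
`B11Leaf Z`, then `Dag.B11_main (leavesP w P)` at every `Rec`-world and every run. [cite: Balaban1985Variational, Thm 1 p.279, Props 2–9 pp.281–309 (bookkeeping)] -/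
theorem b11_main_of_record (Rec : WorldP → Prop)
    (hRec : ∀ w, Rec w → ∀ P : B12.RunParams, ∃ (X : PrintedCarriersR) (Y : PrintedCarriers9X) (Z : PrintedCarriers11)
      (V : PrintedCarriers14R) (W : PrintedCarriers15), w.up P = Upstream.ofPrintedAllXPN X Y Z V W ∧ B11Leaf Z)
    (w : WorldP) (hw : Rec w) (P : B12.RunParams) : Dag.B11_main (leavesP w P) := by
  obtain ⟨X, Y, Z, V, W, hP, hZ⟩ := hRec w hw P
  exact b11_main_of_leaf w P X Y Z V W hP hZ

end Literature.MathematicalPhysics.QuantumFieldTheory.Balaban1983to89.B11LeafKnit
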